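import Literature.Analysis.ODE.TorusInverseFlowTransport
import Literature.Analysis.FunctionSpaces.TorusAnalyticProduct
import HarnessLib

/-!
# Armstrong–Vicol App. A Prop. 7.10 (second display) for flows with a regular inverse:
# `⟦(∇X)(t, X⁻¹(t,·))⟧_{n, R_f(1+4|t|dC_fR_f)²} ≤ (d−1)! (20d)^{d−1}`

Analysis/ODE proof file (theorems only; no definitions, no named facts). This is the tree's named
fact `Torus.ArmstrongVicol2025_flowGrad_comp_inv` (Armstrong–Vicol, *Anomalous diffusion by fractal
homogenization*, Ann. PDE 11 (2025), App. A Prop. 7.10, second display, p. 73) PROVED under the one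
additional hypothesis that the inverse flow is `X⁻¹(t) = id + proj ∘ Dinv(t)` with a jointly smooth
inverse displacement `Dinv` (which the cell's Lagrangian carriers supply: `LevelRegular`); the fact as
typed quantifies over an arbitrary two-sided inverse `Xinv` and needs, in addition, the smoothness of
`Xinv` from the inverse function theorem — not done here.

The printed proof, line by line: `Y := X⁻¹ − id` solves `(∂ₜ + f·∇)Y = −f`, `Y(0) = 0`
(`TorusFlow.hasDerivAt_dispInv`), so Cor. 7.8 (DISCHARGED: `Torus.ArmstrongVicol2025_transportShift_grad_holds`)
with `g = −f`, `R_g = R_f`, `C_g = C_f` gives `⟦∂ⱼYᵢ(t)⟧_{n,R} ≤ 4d` at `R = R_f(1+4|t|dC_fR_f)²`,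
`n + 1 ≤ N` (`TorusFlow.dnorm_partialDeriv_dispInv_le`); hence every entry of `1 + ∇Y(t)` has
`⟦·⟧_{n',R} ≤ 1 + 4d ≤ 5d` for all `n' ≤ n` (§1). By incompressibility `det(1 + ∇Y) = 1` and
`(∇X)∘X⁻¹ = (1 + ∇Y)⁻¹ = adj(1 + ∇Y)` (`TorusFlow.flowGrad_comp_inv_eq_adjugate`); an adjugate entry of a
`d × d` matrix is, up to sign, a `(d−1) × (d−1)` minor (`Matrix.adjugate_fin_succ_eq_det_submatrix` after
reindexing `d ≃ Fin d`), i.e. a signed sum of `(d−1)!` products of `d−1` entries; by Lemma 7.1 with the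
printed constant `4` (`Torus.dnorm_mul_le_four`), a product of `m` factors with all seminorms `≤ B` has
seminorms `≤ 4^m B^m` (§2), so `⟦adj(1+∇Y)ᵢⱼ⟧_{n,R} ≤ (d−1)! · 4^{d−1} (5d)^{d−1} = (d−1)! (20d)^{d−1}` (§3).

* §1 `dnorm_const_le`, `dnorm_finset_sum_le`, seminorm bounds of the entries of `1 + ∇Dinv(t)`;
* §2 `dnorm_finset_prod_le_pow` — products of `m` factors: `⟦∏ F⟧_{n',R} ≤ 4^m B^m`;
* §3 `dnorm_det_le`, `dnorm_adjugate_entry_le` and the main theorem `dnorm_flowGrad_comp_inv_le`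
  (= Prop. 7.10, second display, with regular inverse), also in the binder shape of the named fact
  plus the regularity hypothesis (`flowGrad_comp_inv_of_regularInverse`).

## References

* S. Armstrong, V. Vicol, *Anomalous diffusion by fractal homogenization*, Ann. PDE 11 (2025),
  arXiv:2305.05048, App. A Prop. 7.10 (second display) and its proof, p. 73; Lemma 7.1; Cor. 7.8.
  [`ArmstrongVicol2025`]
-/

noncomputable section

open Set Filter Topology Function Matrix Finset

namespace Literature.Analysis.ODE

namespace TorusFlow

open Literature.Analysis.FunctionSpaces Literature.Analysis.FunctionSpaces.Torus Literature.Analysis.Calculus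

variable {d : Type*} [Fintype d] [DecidableEq d]

/-! ## §1 Seminorms of constants, sums, and of the entries of `1 + ∇Dinv` -/

omit [Fintype d] in
/-- Constants: `⟦c⟧_{n,R} ≤ |c|` (`= |c|` for `n = 0`, `= 0` for `n ≥ 1`). [cite: ArmstrongVicol2025, App. A (A.1)] -/
theorem dnorm_const_le (n : ℕ) {R : ℝ} (hR : 0 < R) (c : ℝ) :
    dnorm n R (fun _ : UnitAddTorus d => c) ≤ |c| := by
  refine dnorm_le_of_forall_norm_iterPartialDeriv_le hR (abs_nonneg c) fun l hl y => ?_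
  by_cases hln : l = []
  · subst hln
    simp only [List.length_nil] at hl
    subst hl
    simp [iterPartialDeriv_nil, Real.norm_eq_abs]
  · rw [iterPartialDeriv_const c l hln]
    simp only [Pi.zero_apply, norm_zero]
    positivity

omit [DecidableEq d] in
/-- Finite sums of smooth real functions are smooth. [folklore] -/
private theorem isSmooth_finset_sum' {ι : Type*} (s : Finset ι) {F : ι → UnitAddTorus d → ℝ}
    (hF : ∀ a ∈ s, IsSmooth (F a)) : IsSmooth (fun y => ∑ a ∈ s, F a y) := by
  unfold IsSmooth at hF ⊢
  have e : lift (fun y => ∑ a ∈ s, F a y) = fun v => ∑ a ∈ s, lift (F a) v := rfl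
  rw [e]
  exact ContDiff.sum fun a ha => hF a ha

omit [DecidableEq d] in
/-- Finite products of smooth real functions are smooth. [folklore] -/
private theorem isSmooth_finset_prod' {ι : Type*} (s : Finset ι) {F : ι → UnitAddTorus d → ℝ}
    (hF : ∀ a ∈ s, IsSmooth (F a)) : IsSmooth (fun y => ∏ a ∈ s, F a y) := by
  unfold IsSmooth at hF ⊢
  have e : lift (fun y => ∏ a ∈ s, F a y) = fun v => ∏ a ∈ s, lift (F a) v := rfl
  rw [e]
  exact contDiff_prod fun a ha => hF a ha

/-- **Subadditivity over finite sums**: `⟦Σₐ Fₐ⟧_{n,R} ≤ Σₐ ⟦Fₐ⟧_{n,R}` for smooth `Fₐ`.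
[cite: ArmstrongVicol2025, App. A (A.1)] -/
theorem dnorm_finset_sum_le {ι : Type*} (s : Finset ι) (n : ℕ) {R : ℝ} (hR : 0 < R)
    {F : ι → UnitAddTorus d → ℝ} (hF : ∀ a ∈ s, IsSmooth (F a)) :
    dnorm n R (fun y => ∑ a ∈ s, F a y) ≤ ∑ a ∈ s, dnorm n R (F a) := by
  classical
  induction s using Finset.induction_on with
  | empty =>
    simp only [Finset.sum_empty]
    have := dnorm_const_le (d := d) n hR 0
    rwa [abs_zero] at this
  | insert a s ha ih =>
    have hFa : IsSmooth (F a) := hF a (Finset.mem_insert_self a s)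
    have hFs : ∀ b ∈ s, IsSmooth (F b) := fun b hb => hF b (Finset.mem_insert_of_mem hb)
    simp only [Finset.sum_insert ha]
    exact (dnorm_add_le n hR hFa (isSmooth_finset_sum' s hFs)).trans (by gcongr; exact ih hFs)

/-! ## §2 Products of `m` factors: `⟦∏ F⟧ ≤ 4^m B^m` -/

/-- **Iterated product estimate** (Lemma 7.1 with the printed constant, iterated): if every factor
`Fₐ`, `a ∈ s`, is smooth with `⟦Fₐ⟧_{j,R} ≤ B` for all `j ≤ n`, then
`⟦∏_{a∈s} Fₐ⟧_{j,R} ≤ 4^{|s|} B^{|s|}` for all `j ≤ n`. [cite: ArmstrongVicol2025, App. A Lemma 7.1] -/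
theorem dnorm_finset_prod_le_pow {ι : Type*} (s : Finset ι) (n : ℕ) {R B : ℝ} (hR : 0 < R)
    {F : ι → UnitAddTorus d → ℝ} (hF : ∀ a ∈ s, IsSmooth (F a))
    (hB : ∀ a ∈ s, ∀ j ≤ n, dnorm j R (F a) ≤ B) :
    ∀ j ≤ n, dnorm j R (fun y => ∏ a ∈ s, F a y) ≤ (4 : ℝ) ^ s.card * B ^ s.card := by
  classical
  induction s using Finset.induction_on with
  | empty =>
    intro j _
    simp only [Finset.prod_empty, Finset.card_empty, pow_zero, mul_one]
    have := dnorm_const_le (d := d) j hR 1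
    rwa [abs_one] at this
  | insert a s ha ih =>
    intro j hj
    have hFa : IsSmooth (F a) := hF a (Finset.mem_insert_self a s)
    have hFs : ∀ b ∈ s, IsSmooth (F b) := fun b hb => hF b (Finset.mem_insert_of_mem hb)
    have hBs : ∀ b ∈ s, ∀ j ≤ n, dnorm j R (F b) ≤ B := fun b hb => hB b (Finset.mem_insert_of_mem hb)
    have ih' := ih hFs hBs
    simp only [Finset.prod_insert ha, Finset.card_insert_of_notMem ha]
    have h := dnorm_mul_le_four (n := j) hFa (isSmooth_finset_prod' s hFs) hR
      (fun i hi => hB a (Finset.mem_insert_self a s) i (hi.trans hj)) (fun i hi => ih' i (hi.trans hj))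
    calc dnorm j R (fun y => F a y * ∏ b ∈ s, F b y) ≤ 4 * B * ((4 : ℝ) ^ s.card * B ^ s.card) := h
      _ = (4 : ℝ) ^ (s.card + 1) * B ^ (s.card + 1) := by ring

/-! ## §3 Determinants, adjugate entries, and Prop. 7.10 -/

omit [DecidableEq d] in
/-- `|ε σ| = 1` for the sign of a permutation, as a real number. [folklore] -/
private theorem abs_sign_cast {ι : Type*} [Fintype ι] [DecidableEq ι] (σ : Equiv.Perm ι) :
    |((Equiv.Perm.sign σ : ℤ) : ℝ)| = 1 := by
  rcases Int.units_eq_one_or (Equiv.Perm.sign σ) with h | h <;> simp [h]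

/-- **Seminorm of a determinant of smooth entries**: for an `m × m` matrix of smooth real functions
whose entries satisfy `⟦N_{ab}⟧_{j,R} ≤ B` for all `j ≤ n`,
`⟦det N⟧_{n,R} ≤ m! · 4^m B^m` (Leibniz formula, `dnorm_finset_prod_le_pow`, subadditivity).
[cite: ArmstrongVicol2025, App. A Prop. 7.10 (proof, p. 73)] -/
theorem dnorm_det_le {ι : Type*} [Fintype ι] [DecidableEq ι] (n : ℕ) {R B : ℝ} (hR : 0 < R)
    {N : ι → ι → UnitAddTorus d → ℝ} (hN : ∀ a b, IsSmooth (N a b))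
    (hB : ∀ a b, ∀ j ≤ n, dnorm j R (N a b) ≤ B) :
    dnorm n R (fun y => (Matrix.of fun a b => N a b y).det) ≤
      (Nat.factorial (Fintype.card ι) : ℝ) * ((4 : ℝ) ^ Fintype.card ι * B ^ Fintype.card ι) := by
  have e : (fun y => (Matrix.of fun a b => N a b y).det) =
      fun y => ∑ σ : Equiv.Perm ι, ((Equiv.Perm.sign σ : ℤ) : ℝ) * ∏ b, N (σ b) b y := by
    funext y
    rw [Matrix.det_apply']
    rfl
  rw [e]
  have hterm : ∀ σ : Equiv.Perm ι, IsSmooth (fun y => ((Equiv.Perm.sign σ : ℤ) : ℝ) * ∏ b, N (σ b) b y) :=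
    fun σ => (isSmooth_const _).smul' (isSmooth_finset_prod' _ fun b _ => hN (σ b) b)
  refine (dnorm_finset_sum_le _ n hR fun σ _ => hterm σ).trans ?_
  have hbound : ∀ σ : Equiv.Perm ι, dnorm n R (fun y => ((Equiv.Perm.sign σ : ℤ) : ℝ) * ∏ b, N (σ b) b y) ≤
      (4 : ℝ) ^ Fintype.card ι * B ^ Fintype.card ι := by
    intro σ
    have h1 := dnorm_const_smul_le n hR (f := fun y => ∏ b, N (σ b) b y)
      (isSmooth_finset_prod' (Finset.univ : Finset ι) fun b _ => hN (σ b) b) ((Equiv.Perm.sign σ : ℤ) : ℝ)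
    have h2 := dnorm_finset_prod_le_pow (Finset.univ : Finset ι) n hR (F := fun b => N (σ b) b)
      (fun b _ => hN (σ b) b) (fun b _ => hB (σ b) b) n le_rfl
    rw [Finset.card_univ] at h2
    rw [abs_sign_cast, one_mul] at h1
    exact h1.trans h2
  calc ∑ σ : Equiv.Perm ι, dnorm n R (fun y => ((Equiv.Perm.sign σ : ℤ) : ℝ) * ∏ b, N (σ b) b y)
      ≤ ∑ _σ : Equiv.Perm ι, (4 : ℝ) ^ Fintype.card ι * B ^ Fintype.card ι := Finset.sum_le_sum fun σ _ => hbound σ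
    _ = (Nat.factorial (Fintype.card ι) : ℝ) * ((4 : ℝ) ^ Fintype.card ι * B ^ Fintype.card ι) := by
        rw [Finset.sum_const, Finset.card_univ, Fintype.card_perm, nsmul_eq_mul]

/-- **Seminorm of an adjugate entry**: for a `d × d` matrix `M(y)` of smooth real functions with
`⟦M_{kl}⟧_{j,R} ≤ B` for all `j ≤ n`, every entry of `adj M(y)` has
`⟦(adj M)ᵢⱼ⟧_{n,R} ≤ (d−1)! · 4^{d−1} B^{d−1}` (an adjugate entry is, up to sign, a `(d−1) × (d−1)`
minor: reindex `d ≃ Fin d` and `Matrix.adjugate_fin_succ_eq_det_submatrix`).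
[cite: ArmstrongVicol2025, App. A Prop. 7.10 (proof, p. 73)] -/
theorem dnorm_adjugate_entry_le (n : ℕ) {R B : ℝ} (hR : 0 < R)
    {M : d → d → UnitAddTorus d → ℝ} (hM : ∀ k l, IsSmooth (M k l)) (hB : ∀ k l, ∀ j ≤ n, dnorm j R (M k l) ≤ B)
    (i j : d) :
    dnorm n R (fun y => (Matrix.of fun k l => M k l y).adjugate i j) ≤
      (Nat.factorial (Fintype.card d - 1) : ℝ) * ((4 : ℝ) ^ (Fintype.card d - 1) * B ^ (Fintype.card d - 1)) := by
  -- reindex `d ≃ Fin (m+1)`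
  set m : ℕ := Fintype.card d - 1 with hm
  have hcard : Fintype.card d = m + 1 := by
    have : 0 < Fintype.card d := Fintype.card_pos_iff.2 ⟨i⟩
    omega
  set e : Fin (m + 1) ≃ d := (Fintype.equivFinOfCardEq hcard).symm with he
  -- the adjugate entry as a signed minor of the reindexed matrix
  have hentry : ∀ y, (Matrix.of fun k l => M k l y).adjugate i j =
      (-1) ^ ((e.symm j : ℕ) + (e.symm i : ℕ)) *
        (Matrix.of fun p q => M (e ((e.symm j).succAbove p)) (e ((e.symm i).succAbove q)) y).det := by
    intro y
    set A : Matrix d d ℝ := Matrix.of fun k l => M k l y with hA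
    have h1 : A.adjugate i j = (A.submatrix e e).adjugate (e.symm i) (e.symm j) := by
      rw [Matrix.adjugate_submatrix_equiv_self, Matrix.submatrix_apply, Equiv.apply_symm_apply,
        Equiv.apply_symm_apply]
    rw [h1, Matrix.adjugate_fin_succ_eq_det_submatrix]
    rfl
  rw [show (fun y => (Matrix.of fun k l => M k l y).adjugate i j) = fun y =>
      (-1 : ℝ) ^ ((e.symm j : ℕ) + (e.symm i : ℕ)) *
        (Matrix.of fun p q => M (e ((e.symm j).succAbove p)) (e ((e.symm i).succAbove q)) y).det from
    funext hentry]
  have hN : ∀ p q : Fin m, IsSmooth (M (e ((e.symm j).succAbove p)) (e ((e.symm i).succAbove q))) :=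
    fun p q => hM _ _
  have hdet := dnorm_det_le n hR hN (fun p q => hB _ _)
  have hsm : IsSmooth (fun y => (Matrix.of fun p q =>
      M (e ((e.symm j).succAbove p)) (e ((e.symm i).succAbove q)) y).det) := by
    have e1 : (fun y => (Matrix.of fun p q => M (e ((e.symm j).succAbove p)) (e ((e.symm i).succAbove q)) y).det) =
        fun y => ∑ σ : Equiv.Perm (Fin m), ((Equiv.Perm.sign σ : ℤ) : ℝ) *
          ∏ b, M (e ((e.symm j).succAbove (σ b))) (e ((e.symm i).succAbove b)) y := by
      funext y; rw [Matrix.det_apply']; rfl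
    rw [e1]
    exact isSmooth_finset_sum' _ fun σ _ => (isSmooth_const _).smul' (isSmooth_finset_prod' _ fun b _ => hM _ _)
  have h1 := dnorm_const_smul_le n hR hsm ((-1 : ℝ) ^ ((e.symm j : ℕ) + (e.symm i : ℕ)))
  rw [abs_pow, abs_neg, abs_one, one_pow, one_mul] at h1
  rw [Fintype.card_fin] at hdet
  exact h1.trans hdet

variable {f D Dinv : ℝ → UnitAddTorus d → EuclideanSpace ℝ d}

/-- **Armstrong–Vicol, App. A Prop. 7.10 (second display), for flows with a regular inverse.** Let `f`
be jointly smooth and divergence free with `max_{1≤n≤N} sup_t ⟦f(t)⟧_{n,R_f} ≤ C_f`, `X(t) = id + proj∘D(t)`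
its flow (`D` jointly smooth, `D(0) = 0`, `∂ₜD = f∘X`) and `X⁻¹(t) = id + proj∘Dinv(t)` a two-sided
inverse with `Dinv` jointly smooth. Then for `n + 1 ≤ N`, `|t| ≤ T = 1/(4dC_fR_f)` and all `i, j`,

  `⟦(1 + ∇D)ᵢⱼ(t, X⁻¹(t,·))⟧_{n, R_f(1 + 4|t| d C_f R_f)²} ≤ (d−1)! (20 d)^{d−1}`.

[cite: ArmstrongVicol2025, App. A Prop. 7.10 (arXiv §7.3 p. 73, second display)] -/
theorem dnorm_flowGrad_comp_inv_le (N : ℕ) {Cf Rf : ℝ} (hCf : 0 < Cf) (hRf : 0 < Rf)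
    (hf : IsSmoothSpaceTimeOn univ f) (hD : IsSmoothSpaceTimeOn univ D) (hDinv : IsSmoothSpaceTimeOn univ Dinv)
    (hdiv : ∀ t, IsDivFree (f t)) (hD0 : ∀ x, D 0 x = 0)
    (hODE : ∀ t x, HasDerivAt (fun s => D s x) (f t (x + proj (D t x))) t)
    (hinv₁ : ∀ t x, (x + proj (D t x)) + proj (Dinv t (x + proj (D t x))) = x)
    (hinv₂ : ∀ t y, (y + proj (Dinv t y)) + proj (D t (y + proj (Dinv t y))) = y)
    (hfb : ∀ n, 1 ≤ n → n ≤ N → ∀ t, dnorm n Rf (f t) ≤ Cf) :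
    ∀ n, n + 1 ≤ N → ∀ t : ℝ, |t| ≤ 1 / (4 * (Fintype.card d : ℝ) * Cf * Rf) →
      ∀ i j : d, dnorm n (Rf * (1 + 4 * |t| * (Fintype.card d : ℝ) * Cf * Rf) ^ 2)
          (fun y => (1 : Matrix d d ℝ) i j + partialDeriv j (fun x => D t x i) (y + proj (Dinv t y))) ≤
        (Nat.factorial (Fintype.card d - 1) : ℝ) * (20 * (Fintype.card d : ℝ)) ^ (Fintype.card d - 1) := by
  intro n hn t ht i j
  set R : ℝ := Rf * (1 + 4 * |t| * (Fintype.card d : ℝ) * Cf * Rf) ^ 2 with hRdef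
  have hdpos : (0 : ℝ) < (Fintype.card d : ℝ) := by
    have : 0 < Fintype.card d := Fintype.card_pos_iff.2 ⟨i⟩
    exact_mod_cast this
  have hd1 : (1 : ℝ) ≤ (Fintype.card d : ℝ) := by
    have : 1 ≤ Fintype.card d := Fintype.card_pos_iff.2 ⟨i⟩
    exact_mod_cast this
  have hR : 0 < R := by positivity
  -- the entries of `1 + ∇Dinv(t)` and their seminorm bounds `≤ 5d` at all orders `≤ n`
  set M : d → d → UnitAddTorus d → ℝ := fun k l y =>
    (1 : Matrix d d ℝ) k l + partialDeriv l (fun z => Dinv t z k) y with hMdef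
  have hDinvk : ∀ k, IsSmooth (fun z => Dinv t z k) := fun k => ((hDinv.isSmooth_slice (mem_univ t)).apply k)
  have hMs : ∀ k l, IsSmooth (M k l) := fun k l => (isSmooth_const _).add ((hDinvk k).partialDeriv l)
  have hMB : ∀ k l, ∀ j' ≤ n, dnorm j' R (M k l) ≤ 5 * (Fintype.card d : ℝ) := by
    intro k l j' hj'
    have hY := dnorm_partialDeriv_dispInv_le (f := f) (D := D) (Dinv := Dinv) N hCf hRf hf hDinv hD0 hODE hinv₁ hinv₂ hfb
      j' (by omega) t ht k l
    have hc := dnorm_const_le (d := d) j' hR ((1 : Matrix d d ℝ) k l)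
    have hc1 : |(1 : Matrix d d ℝ) k l| ≤ 1 := by
      rw [Matrix.one_apply]; split_ifs <;> simp
    calc dnorm j' R (M k l) ≤ dnorm j' R (fun _ : UnitAddTorus d => (1 : Matrix d d ℝ) k l) +
          dnorm j' R (fun y => partialDeriv l (fun z => Dinv t z k) y) :=
          dnorm_add_le j' hR (isSmooth_const _) ((hDinvk k).partialDeriv l)
      _ ≤ 1 + 4 * (Fintype.card d : ℝ) := add_le_add (hc.trans hc1) hY
      _ ≤ 5 * (Fintype.card d : ℝ) := by linarith
  -- `(1 + ∇D)(X⁻¹ y) = adj (1 + ∇Dinv(y))`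
  have hadj : (fun y => (1 : Matrix d d ℝ) i j + partialDeriv j (fun x => D t x i) (y + proj (Dinv t y))) =
      fun y => (Matrix.of fun k l => M k l y).adjugate i j := by
    funext y
    have h := flowGrad_comp_inv_eq_adjugate hf hD hDinv hD0 hODE hdiv hinv₂ t y
    have h' := congrFun (congrFun h i) j
    simp only [Matrix.of_apply] at h'
    rw [h']
  rw [hadj]
  refine (dnorm_adjugate_entry_le n hR hMs hMB i j).trans (le_of_eq ?_)
  rw [← mul_pow, show (4 : ℝ) * (5 * (Fintype.card d : ℝ)) = 20 * (Fintype.card d : ℝ) by ring]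

/-- **Prop. 7.10 in the binder shape of the named fact `Torus.ArmstrongVicol2025_flowGrad_comp_inv`, plus
the regularity of the inverse**: for every two-sided inverse `Xinv` of the flow that is of the form
`Xinv(t,y) = y + proj Dinv(t,y)` with `Dinv` jointly smooth, the printed estimate holds.
[cite: ArmstrongVicol2025, App. A Prop. 7.10 (arXiv §7.3 p. 73, second display)] -/
theorem flowGrad_comp_inv_of_regularInverse (N : ℕ) (f D : ℝ → UnitAddTorus d → EuclideanSpace ℝ d)
    (Xinv : ℝ → UnitAddTorus d → UnitAddTorus d) (Cf Rf : ℝ) (hCf : 0 < Cf) (hRf : 0 < Rf)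
    (hf : IsSmoothSpaceTimeOn univ f) (hD : IsSmoothSpaceTimeOn univ D) (hdiv : ∀ t, IsDivFree (f t))
    (hD0 : ∀ x, D 0 x = 0) (hODE : ∀ t x, HasDerivAt (fun s => D s x) (f t (x + proj (D t x))) t)
    (hinv₁ : ∀ t x, Xinv t (x + proj (D t x)) = x) (hinv₂ : ∀ t y, Xinv t y + proj (D t (Xinv t y)) = y)
    (hfb : ∀ n, 1 ≤ n → n ≤ N → ∀ t, dnorm n Rf (f t) ≤ Cf)
    {Dinv : ℝ → UnitAddTorus d → EuclideanSpace ℝ d} (hDinv : IsSmoothSpaceTimeOn univ Dinv)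
    (hXinv : ∀ t y, Xinv t y = y + proj (Dinv t y)) :
    ∀ n, n + 1 ≤ N → ∀ t : ℝ, |t| ≤ 1 / (4 * (Fintype.card d : ℝ) * Cf * Rf) →
      ∀ i j : d, dnorm n (Rf * (1 + 4 * |t| * (Fintype.card d : ℝ) * Cf * Rf) ^ 2)
          (fun y => (1 : Matrix d d ℝ) i j + partialDeriv j (fun x => D t x i) (Xinv t y)) ≤
        (Nat.factorial (Fintype.card d - 1) : ℝ) * (20 * (Fintype.card d : ℝ)) ^ (Fintype.card d - 1) := by
  have hinv₁' : ∀ t x, (x + proj (D t x)) + proj (Dinv t (x + proj (D t x))) = x := fun t x => by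
    rw [← hXinv]; exact hinv₁ t x
  have hinv₂' : ∀ t y, (y + proj (Dinv t y)) + proj (D t (y + proj (Dinv t y))) = y := fun t y => by
    rw [← hXinv]; exact hinv₂ t y
  intro n hn t ht i j
  have h := dnorm_flowGrad_comp_inv_le N hCf hRf hf hD hDinv hdiv hD0 hODE hinv₁' hinv₂' hfb n hn t ht i j
  simp only [← hXinv] at h
  exact h

end TorusFlow

end Literature.Analysis.ODE

end
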